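import Summits.CriticalPhenomena.PercolationContinuityZ3.Theorems.FK.InfiniteVolumeOneEdgeDLR
import Summits.CriticalPhenomena.PercolationContinuityZ3.Theorems.FK.UniquenessInfiniteClusterFKCanonical
import Literature.Probability.Percolation.ConnectivityThetaSqProofs
import Literature.Probability.Percolation.NewmanSchulman
import HarnessLib

/-!
# FK-continuity transplant, FO-06 (construction half): the DLR (Gibbs) property of the box limits
# `φ^b_{p,q}` in the one-edge form — Grimmett 2006, Thm. (4.34)(b) with Prop. (4.37), eq. (4.38);
# part 2: the half that needs the uniqueness of the infinite cluster, and the assembled statement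

Cell `fk-continuity` (bschramm), row FO-06b-5; support file for the FK-continuity transplant
(`--supports stmt-CriticalPhenomena-4575`); builds on p205010 (kernel theorem, internal audit signed;
external expert review pending). No named facts, no sorries, standard axioms. General dimension `d`,
both boundary conditions `b`.

For a box limit `P` (`IsBoxLimit d b p q P`, `0 ≤ p ≤ 1`, `q ≥ 1`), a lattice edge `e = ⟨x,y⟩`, the
events `J_e = {e open}`, `K_e = {x ↔ y in ω ∖ e}` and an event `H` determined by finitely many pairs
other than `e`:

* `IsBoxLimit.real_edgeOpen_inter_not_offEdgeConn_eq_mul_of_ae` — **Grimmett's (4.38), second case**: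
  `P(J_e ∩ H ∖ K_e) = p/(p + q(1-p)) · P(H ∖ K_e)` for any box limit with
  `huniq : ∀ᵐ ω ∂P, numInfiniteClusters ω ≤ 1` (the 0/1-infinite-cluster property of Thm. (4.31));
  `IsBoxLimit.real_edgeOpen_inter_not_offEdgeConn_eq_mul` — the same HYPOTHESIS-FREE, the uniqueness
  being the cell's FO-08 theorem `IsBoxLimit.ae_numInfiniteClusters_le_one'` (Burton–Keane for
  `φ^b_{p,q}`, `UniquenessInfiniteClusterFKCanonical.lean`, over 06a's `IsBoxLimit.fkGibbs`);
* `IsBoxLimit.real_edgeOpen_inter_eq` — **(4.38) assembled, hypothesis-free**: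
  `P(J_e ∩ H) = p · P(H ∩ K_e) + p/(p+q(1-p)) · P(H ∖ K_e)`, i.e. `P(J_e | T_e) = φ^ω_{e,p,q}(J_e)`,
  the DLR equation (4.30) for the region consisting of the single edge `e` (by Prop. (4.37)(b) this
  one-edge form is equivalent to the DLR property for all boxes; that equivalence is not formalised
  here); `rcLimit_real_edgeOpen_inter_eq` for `φ^b_{p,q} = rcLimit d b p q`.

Proof of the second case (Grimmett's proof of Thm. (4.31), pp. 84–86, for one edge): by part 1, in
the box `Λ_n` the deviation of `φ^b_{Λ_n}(J_e ∩ H ∩ M_m)` from `p'·φ^b_{Λ_n}(H ∩ M_m)`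
(`M_m = {¬ x ↔ y inside Λ_m off e}`, `p' = p/(p+q(1-p))`) is at most `(p - p')·φ^b_{Λ_n}(D_m)` with
`D_m` the LOCAL event "off `e`, both `x` and `y` exit `Λ_m` but are not joined inside `Λ_m`"
(`rcBoxLaw_real_edgeOpen_inter_sub_mul_mem_Icc`); let `n → ∞`, then `m → ∞`: `M_m ↓ K_eᶜ`, and
`limsup_m D_m ⊆ {ω ∖ e has two infinite clusters}` (`mem_iInter_iUnion_exit_subset`), an event of
probability `0` by deletion tolerance (`InfiniteVolumeFiniteEnergy.lean`, Grimmett's (4.42)) and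
`huniq`; for `p = 1` the coefficient `p - p'` vanishes.

## References

* G. Grimmett, *The Random-Cluster Model*, Springer 2006: Thm. (3.1)(a) eq. (3.3); Def. (4.29)–(4.30),
  Thm. (4.31), (4.34)(b), Prop. (4.37) eq. (4.38), Lemma (4.39) eqs. (4.40)–(4.42), proof of Thm. (4.31)
  eqs. (4.45)–(4.53), pp. 81–86. [Grimmett2006]
* R. M. Burton, M. Keane, Comm. Math. Phys. 121 (1989) 501–505. [BurtonKeane1989]
-/

noncomputable section

open MeasureTheory Set Filter
open scoped Topology ENNReal

namespace Summit.CriticalPhenomena.PercolationContinuityZ3.Theorems.FK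

open Literature.Probability.Percolation Literature.Probability.LatticeModels

variable {d : ℕ}

/-! ### Deterministic: exiting every box means percolating -/

section Deterministic

/-- If `z` is joined (inside `Λ_{m+1}`) to a site outside `Λ_m` for arbitrarily large `m`, the open
cluster of `z` is infinite. [cite: Grimmett2006, Lemma (4.39), "⋂_Δ D_{Λ,Δ} = {I_Λ ≥ 2}"] -/
theorem mem_percolatesAt_of_frequently_exit {η : BondConfig (Site d)} {z : Site d}
    (h : ∀ N : ℕ, ∃ m, N ≤ m ∧ ∃ c ∈ box d (m + 1), c ∉ box d m ∧
      η ∈ openConnVia (withinGraph ⊤ (↑(box d (m + 1)) : Set (Site d))) z c) :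
    η ∈ percolatesAt z := by
  intro hfin
  obtain ⟨N, hN⟩ := DCT16.exists_subset_box hfin.toFinset
  obtain ⟨m, hNm, c, -, hcm, hc⟩ := h N
  have hcC : c ∈ openCluster η z := openClusterIn_subset_openCluster _ η z hc
  exact hcm (box_mono d hNm (hN (hfin.mem_toFinset.2 hcC)))

/-- If `x, y` fail to be joined inside `Λ_m` for arbitrarily large `m`, they are not joined at all
(the box-constrained connections increase to `{x ↔ y}`). [cite: Grimmett2006, Lemma (4.39)] -/
theorem not_mem_openConn_of_frequently {η : BondConfig (Site d)} {x y : Site d}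
    (h : ∀ N : ℕ, ∃ m, N ≤ m ∧ η ∉ openConnVia (withinGraph ⊤ (↑(box d m) : Set (Site d))) x y) :
    η ∉ openConn x y := by
  intro hη
  rw [openConn_eq_iUnion_openConnVia_box, Set.mem_iUnion] at hη
  obtain ⟨N, hN⟩ := hη
  obtain ⟨m, hNm, hm⟩ := h N
  exact hm (monotone_openConnVia_withinGraph_box x y hNm hN)

/-- **`limsup_m D_m ⊆ {ω ∖ e has two infinite clusters}`** (Grimmett 2006, (4.51) with (4.42), one
edge): if, off `e = s(x,y)` and for arbitrarily large `m`, both `x` and `y` exit `Λ_m` while not being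
joined inside `Λ_m`, then in `ω ∖ e` the clusters of `x` and `y` are infinite and distinct — impossible
when `ω ∖ e` has at most one infinite cluster. [cite: Grimmett2006, Lemma (4.39) eqs. (4.40)–(4.42) and (4.51)] -/
theorem mem_iInter_iUnion_exit_subset (x y : Site d) :
    (⋂ N : ℕ, ⋃ m : ℕ, ⋃ (_ : N ≤ m),
      ((fun η : BondConfig (Site d) => η \ {s(x, y)}) ⁻¹' {ω | ∃ c ∈ box d (m + 1), c ∉ box d m ∧
          ω ∈ openConnVia (withinGraph ⊤ (↑(box d (m + 1)) : Set (Site d))) x c} ∩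
        (fun η : BondConfig (Site d) => η \ {s(x, y)}) ⁻¹' {ω | ∃ c ∈ box d (m + 1), c ∉ box d m ∧
          ω ∈ openConnVia (withinGraph ⊤ (↑(box d (m + 1)) : Set (Site d))) y c} ∩
        ((fun η : BondConfig (Site d) => η \ {s(x, y)}) ⁻¹'
          openConnVia (withinGraph ⊤ (↑(box d m) : Set (Site d))) x y)ᶜ)) ⊆
      (fun η : BondConfig (Site d) => η \ {s(x, y)}) ⁻¹' {ω | ¬ numInfiniteClusters ω ≤ 1} := by
  intro ω hω
  simp only [Set.mem_iInter, Set.mem_iUnion, Set.mem_inter_iff, Set.mem_preimage, Set.mem_compl_iff,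
    exists_prop] at hω
  intro hN1
  have hx : ω \ {s(x, y)} ∈ percolatesAt x :=
    mem_percolatesAt_of_frequently_exit fun N => by
      obtain ⟨m, hNm, ⟨hx, -⟩, -⟩ := hω N
      exact ⟨m, hNm, hx⟩
  have hy : ω \ {s(x, y)} ∈ percolatesAt y :=
    mem_percolatesAt_of_frequently_exit fun N => by
      obtain ⟨m, hNm, ⟨-, hy⟩, -⟩ := hω N
      exact ⟨m, hNm, hy⟩
  have hxy : ω \ {s(x, y)} ∉ openConn x y :=
    not_mem_openConn_of_frequently fun N => by
      obtain ⟨m, hNm, -, hK⟩ := hω N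
      exact ⟨m, hNm, hK⟩
  exact hxy (mem_openConn_of_numInfiniteClusters_le_one hN1 hx hy)

/-- `{N ≤ 1}ᶜ` is measurable (`N` the number of infinite clusters). [folklore] -/
theorem measurableSet_not_numInfiniteClusters_le_one {V : Type*} [Countable V] :
    MeasurableSet {ω : BondConfig V | ¬ numInfiniteClusters ω ≤ 1} := by
  have h : {ω : BondConfig V | ¬ numInfiniteClusters ω ≤ 1} =
      ({ω | numInfiniteClusters ω = (0 : ℕ)} ∪ {ω | numInfiniteClusters ω = (1 : ℕ)})ᶜ := by
    ext ω
    simp only [Set.mem_setOf_eq, Set.mem_compl_iff, Set.mem_union, Nat.cast_zero, Nat.cast_one]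
    constructor
    · intro h
      rintro (h0 | h1)
      · exact h (h0 ▸ zero_le_one)
      · exact h h1.le
    · intro h hle
      rcases (Order.le_one_iff.1 hle) with h0 | h1
      · exact h (Or.inl h0)
      · exact h (Or.inr h1)
  rw [h]
  exact ((measurableSet_numInfiniteClusters_eq 0).union (measurableSet_numInfiniteClusters_eq 1)).compl

end Deterministic

/-! ### Passing to the limit -/

section Limit

variable {b : Bool} {p q : ℝ} {P : Measure (BondConfig (Site d))}

/-- Real-valued continuity from above for a finite measure. [folklore] -/
theorem tendsto_measureReal_iInter_of_antitone {α : Type*} {mα : MeasurableSpace α} (μ : Measure α)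
    [IsFiniteMeasure μ] {s : ℕ → Set α} (hs : Antitone s) (hsm : ∀ m, MeasurableSet (s m)) :
    Tendsto (fun m => μ.real (s m)) atTop (𝓝 (μ.real (⋂ m, s m))) := by
  have h := tendsto_measure_iInter_atTop (μ := μ) (fun m => (hsm m).nullMeasurableSet) hs
    ⟨0, measure_ne_top μ _⟩
  exact (ENNReal.tendsto_toReal (measure_ne_top μ _)).comp h

/-- **Deletion tolerance + uniqueness kill the bad event**: for a box limit with `p < 1`, `q ≥ 1` and
a.s. at most one infinite cluster, `P{ω | ω ∖ e has ≥ 2 infinite clusters} = 0` (closing `e` costs at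
most the factor `1/(1-p)`, Grimmett's (4.42)). [cite: Grimmett2006, Lemma (4.39) eq. (4.42)] -/
theorem IsBoxLimit.real_preimage_diff_not_numInfiniteClusters_le_one (hP : IsBoxLimit d b p q P)
    (hp : p ∈ Set.Ico (0 : ℝ) 1) (hq : 1 ≤ q) (huniq : ∀ᵐ ω ∂P, numInfiniteClusters ω ≤ 1)
    (e : Sym2 (Site d)) :
    P.real ((fun η : BondConfig (Site d) => η \ {e}) ⁻¹' {ω | ¬ numInfiniteClusters ω ≤ 1}) = 0 := by
  classical
  haveI := hP.isProbabilityMeasure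
  have h0 : P.real {ω : BondConfig (Site d) | ¬ numInfiniteClusters ω ≤ 1} = 0 := by
    rw [measureReal_def, ae_iff.1 huniq, ENNReal.toReal_zero]
  have h1 := hP.pow_mul_real_preimage_sdiff_le ⟨hp.1, hp.2.le⟩ hq ({e} : Finset (Sym2 (Site d)))
    (measurableSet_not_numInfiniteClusters_le_one (V := Site d))
  rw [Finset.card_singleton, pow_one, Finset.coe_singleton, h0] at h1
  have hpos : 0 < 1 - p := sub_pos.2 hp.2
  have h2 : P.real ((fun η : BondConfig (Site d) => η \ {e}) ⁻¹' {ω | ¬ numInfiniteClusters ω ≤ 1}) ≤ 0 :=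
    le_of_mul_le_mul_left (by rw [mul_zero]; exact h1) hpos
  exact le_antisymm h2 measureReal_nonneg

/-- **The bad events have vanishing probability**: for a box limit with `p < 1`, `q ≥ 1` and a.s.
uniqueness, `P(D_m) → 0`, where `D_m = {off e: x and y exit Λ_m, not joined inside Λ_m}`
(`D_m ⊆ ⋃_{k ≥ m} D_k ↓ limsup D ⊆` a null event). [cite: Grimmett2006, proof of Thm. (4.31), last display p. 86, with (4.42)] -/
theorem IsBoxLimit.tendsto_real_exit_inter_not_openConnVia (hP : IsBoxLimit d b p q P)
    (hp : p ∈ Set.Ico (0 : ℝ) 1) (hq : 1 ≤ q) (huniq : ∀ᵐ ω ∂P, numInfiniteClusters ω ≤ 1)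
    (x y : Site d) :
    Tendsto (fun m : ℕ => P.real
      ((fun η : BondConfig (Site d) => η \ {s(x, y)}) ⁻¹' {ω | ∃ c ∈ box d (m + 1), c ∉ box d m ∧
          ω ∈ openConnVia (withinGraph ⊤ (↑(box d (m + 1)) : Set (Site d))) x c} ∩
        (fun η : BondConfig (Site d) => η \ {s(x, y)}) ⁻¹' {ω | ∃ c ∈ box d (m + 1), c ∉ box d m ∧
          ω ∈ openConnVia (withinGraph ⊤ (↑(box d (m + 1)) : Set (Site d))) y c} ∩
        ((fun η : BondConfig (Site d) => η \ {s(x, y)}) ⁻¹'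
          openConnVia (withinGraph ⊤ (↑(box d m) : Set (Site d))) x y)ᶜ)) atTop (𝓝 0) := by
  classical
  haveI := hP.isProbabilityMeasure
  set f : BondConfig (Site d) → BondConfig (Site d) := fun η => η \ {s(x, y)} with hf
  have hfm : Measurable f := measurable_closeEdges _
  set D : ℕ → Set (BondConfig (Site d)) := fun m =>
    f ⁻¹' {ω | ∃ c ∈ box d (m + 1), c ∉ box d m ∧
        ω ∈ openConnVia (withinGraph ⊤ (↑(box d (m + 1)) : Set (Site d))) x c} ∩
      f ⁻¹' {ω | ∃ c ∈ box d (m + 1), c ∉ box d m ∧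
        ω ∈ openConnVia (withinGraph ⊤ (↑(box d (m + 1)) : Set (Site d))) y c} ∩
      (f ⁻¹' openConnVia (withinGraph ⊤ (↑(box d m) : Set (Site d))) x y)ᶜ with hD
  have hDm : ∀ m, MeasurableSet (D m) := fun m =>
    (((measurableSet_of_isLocalEvent_holds (isLocalEvent_exit m x)).preimage hfm).inter
      ((measurableSet_of_isLocalEvent_holds (isLocalEvent_exit m y)).preimage hfm)).inter
      ((measurableSet_openConnVia _ x y).preimage hfm).compl
  -- the decreasing unions `V N = ⋃_{m ≥ N} D m`
  set V : ℕ → Set (BondConfig (Site d)) := fun N => ⋃ m, ⋃ (_ : N ≤ m), D m with hV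
  have hVanti : Antitone V := by
    intro N N' hNN' ω hω
    simp only [hV, Set.mem_iUnion, exists_prop] at hω ⊢
    obtain ⟨m, hm, hωm⟩ := hω
    exact ⟨m, hNN'.trans hm, hωm⟩
  have hVm : ∀ N, MeasurableSet (V N) := fun N =>
    MeasurableSet.iUnion fun m => MeasurableSet.iUnion fun _ => hDm m
  have hV0 : P.real (⋂ N, V N) = 0 := by
    refine le_antisymm ?_ measureReal_nonneg
    calc P.real (⋂ N, V N) ≤ P.real (f ⁻¹' {ω | ¬ numInfiniteClusters ω ≤ 1}) :=
          measureReal_mono (mem_iInter_iUnion_exit_subset x y)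
      _ = 0 := hP.real_preimage_diff_not_numInfiniteClusters_le_one hp hq huniq _
  have hVlim : Tendsto (fun N => P.real (V N)) atTop (𝓝 0) := by
    rw [← hV0]
    exact tendsto_measureReal_iInter_of_antitone P hVanti hVm
  refine squeeze_zero (fun m => measureReal_nonneg) (fun m => ?_) hVlim
  exact measureReal_mono (fun ω hω => Set.mem_iUnion.2 ⟨m, Set.mem_iUnion.2 ⟨le_rfl, hω⟩⟩)
    (measure_ne_top P _)

/-- A triple intersection of local events is local. [folklore] -/
theorem isLocalEvent_inter_inter {ι : Type*} {A B C : Set (Set ι)} (hA : IsLocalEvent A)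
    (hB : IsLocalEvent B) (hC : IsLocalEvent C) : IsLocalEvent (A ∩ B ∩ C) := by
  classical
  obtain ⟨F, hF⟩ := hA
  obtain ⟨G, hG⟩ := hB
  obtain ⟨K, hK⟩ := hC
  refine ⟨F ∪ G ∪ K, ?_⟩
  rw [Finset.coe_union, Finset.coe_union]
  exact ((hF.mono (Set.subset_union_left.trans Set.subset_union_left)).inter
    (hG.mono (Set.subset_union_right.trans Set.subset_union_left))).inter (hK.mono Set.subset_union_right)

/-- **Infinite-volume sandwich at scale `m`** (limit `n → ∞` of `rcBoxLaw_real_edgeOpen_inter_sub_mul_mem_Icc`):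
`0 ≤ P(J_e ∩ H ∩ M_m) - p'·P(H ∩ M_m) ≤ (p - p')·P(D_m)`. [cite: Grimmett2006, proof of Thm. (4.31), eqs. (4.52)–(4.53)] -/
theorem IsBoxLimit.real_edgeOpen_inter_sub_mul_mem_Icc (hP : IsBoxLimit d b p q P)
    (hp : p ∈ Set.Icc (0 : ℝ) 1) (hq : 1 ≤ q) {m : ℕ} {x y : Site d} (hxy : (zdGraph d).Adj x y)
    (hx : x ∈ box d m) (hy : y ∈ box d m) {H : Set (BondConfig (Site d))}
    {T : Finset (Sym2 (Site d))} (hH : DeterminedBy H ↑T) (heT : s(x, y) ∉ T) :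
    P.real ({ω | s(x, y) ∈ ω} ∩ H ∩
        ((fun η => η \ {s(x, y)}) ⁻¹' openConnVia (withinGraph ⊤ (↑(box d m) : Set (Site d))) x y)ᶜ) -
      p / (p + q * (1 - p)) * P.real
        (H ∩ ((fun η => η \ {s(x, y)}) ⁻¹' openConnVia (withinGraph ⊤ (↑(box d m) : Set (Site d))) x y)ᶜ) ∈
      Set.Icc 0 ((p - p / (p + q * (1 - p))) * P.real
        ((fun η => η \ {s(x, y)}) ⁻¹' {ω | ∃ c ∈ box d (m + 1), c ∉ box d m ∧
            ω ∈ openConnVia (withinGraph ⊤ (↑(box d (m + 1)) : Set (Site d))) x c} ∩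
          (fun η => η \ {s(x, y)}) ⁻¹' {ω | ∃ c ∈ box d (m + 1), c ∉ box d m ∧
            ω ∈ openConnVia (withinGraph ⊤ (↑(box d (m + 1)) : Set (Site d))) y c} ∩
          ((fun η => η \ {s(x, y)}) ⁻¹'
            openConnVia (withinGraph ⊤ (↑(box d m) : Set (Site d))) x y)ᶜ)) := by
  classical
  have hHl : IsLocalEvent H := ⟨T, hH⟩
  have heT' : s(x, y) ∉ (↑T : Set (Sym2 (Site d))) := fun h => heT (Finset.mem_coe.1 h)
  have hKl := (isLocalEvent_openConnVia_withinGraph_box m x y (d := d)).compl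
  -- the three local events and their limits
  have h1 := hP.tendsto_real (isLocalEvent_setOf_mem_inter_inter_preimage s(x, y) hHl hKl)
  have h2 := (hP.tendsto_real (isLocalEvent_inter_preimage s(x, y) hHl hKl)).const_mul
    (p / (p + q * (1 - p)))
  have h3 := (hP.tendsto_real (isLocalEvent_inter_inter
    (isLocalEvent_preimage_sdiff (isLocalEvent_exit m x) {s(x, y)})
    (isLocalEvent_preimage_sdiff (isLocalEvent_exit m y) {s(x, y)})
    (isLocalEvent_preimage_sdiff hKl {s(x, y)}))).const_mul (p - p / (p + q * (1 - p)))
  rw [Set.preimage_compl] at h1 h2 h3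
  have hfv : ∀ᶠ n in atTop, (rcBoxLaw d b p q n).real ({ω | s(x, y) ∈ ω} ∩ H ∩
        ((fun η => η \ {s(x, y)}) ⁻¹' openConnVia (withinGraph ⊤ (↑(box d m) : Set (Site d))) x y)ᶜ) -
      p / (p + q * (1 - p)) * (rcBoxLaw d b p q n).real
        (H ∩ ((fun η => η \ {s(x, y)}) ⁻¹' openConnVia (withinGraph ⊤ (↑(box d m) : Set (Site d))) x y)ᶜ) ∈
      Set.Icc 0 ((p - p / (p + q * (1 - p))) * (rcBoxLaw d b p q n).real
        ((fun η => η \ {s(x, y)}) ⁻¹' {ω | ∃ c ∈ box d (m + 1), c ∉ box d m ∧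
            ω ∈ openConnVia (withinGraph ⊤ (↑(box d (m + 1)) : Set (Site d))) x c} ∩
          (fun η => η \ {s(x, y)}) ⁻¹' {ω | ∃ c ∈ box d (m + 1), c ∉ box d m ∧
            ω ∈ openConnVia (withinGraph ⊤ (↑(box d (m + 1)) : Set (Site d))) y c} ∩
          ((fun η => η \ {s(x, y)}) ⁻¹'
            openConnVia (withinGraph ⊤ (↑(box d m) : Set (Site d))) x y)ᶜ)) := by
    filter_upwards [eventually_ge_atTop (m + 1)] with n hn
    exact rcBoxLaw_real_edgeOpen_inter_sub_mul_mem_Icc b hp hq hn hxy hx hy hH heT'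
      (measurableSet_of_isLocalEvent_holds hHl)
  constructor
  · exact ge_of_tendsto (h1.sub h2) (hfv.mono fun n hn => hn.1)
  · exact le_of_tendsto_of_tendsto (h1.sub h2) h3 (hfv.mono fun n hn => hn.2)

/-! ### Grimmett's (4.38), second case -/

/-- **Grimmett 2006, Prop. (4.37) eq. (4.38), second case, for every box limit** (`φ^b_{p,q} ∈ R_{p,q}`,
Thm. (4.34)(b)): for a box limit `P` (`0 ≤ p ≤ 1`, `q ≥ 1`, either boundary condition) with a.s. at
most one infinite cluster, every lattice edge `e = ⟨x,y⟩` and every event `H` determined by finitely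
many pairs other than `e`: `P({e open} ∩ H ∖ K_e) = p/(p + q(1-p)) · P(H ∖ K_e)`, `K_e = {x ↔ y in ω ∖ e}`
— conditionally on `T_e`, off `K_e` the edge `e` is open with probability `p/(p + q(1-p))`.
[cite: Grimmett2006, Thm. (4.34)(b) with Prop. (4.37) eq. (4.38); proof of Thm. (4.31) pp. 84–86] -/
theorem IsBoxLimit.real_edgeOpen_inter_not_offEdgeConn_eq_mul_of_ae (hP : IsBoxLimit d b p q P)
    (hp : p ∈ Set.Icc (0 : ℝ) 1) (hq : 1 ≤ q) (huniq : ∀ᵐ ω ∂P, numInfiniteClusters ω ≤ 1)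
    {x y : Site d} (hxy : (zdGraph d).Adj x y) {H : Set (BondConfig (Site d))}
    {T : Finset (Sym2 (Site d))} (hH : DeterminedBy H ↑T) (heT : s(x, y) ∉ T) :
    P.real ({ω | s(x, y) ∈ ω} ∩ H ∩ ((fun η => η \ {s(x, y)}) ⁻¹' openConn x y)ᶜ) =
      p / (p + q * (1 - p)) * P.real (H ∩ ((fun η => η \ {s(x, y)}) ⁻¹' openConn x y)ᶜ) := by
  classical
  haveI := hP.isProbabilityMeasure
  obtain ⟨m₀, hm₀⟩ := DCT16.exists_subset_box ({x, y} : Finset (Site d))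
  have hx : ∀ m, m₀ ≤ m → x ∈ box d m := fun m hm => box_mono d hm (hm₀ (by simp))
  have hy : ∀ m, m₀ ≤ m → y ∈ box d m := fun m hm => box_mono d hm (hm₀ (by simp))
  have hHm : MeasurableSet H := measurableSet_of_isLocalEvent_holds ⟨T, hH⟩
  set f : BondConfig (Site d) → BondConfig (Site d) := fun η => η \ {s(x, y)} with hf
  have hfm : Measurable f := measurable_closeEdges _
  set Km : ℕ → Set (BondConfig (Site d)) :=
    fun m => openConnVia (withinGraph ⊤ (↑(box d m) : Set (Site d))) x y with hKm
  have hKmm : ∀ m, MeasurableSet (Km m) := fun m => measurableSet_openConnVia _ x y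
  have hmono : Monotone Km := monotone_openConnVia_withinGraph_box x y
  have hunion : (⋃ m, Km m) = openConn x y := (openConn_eq_iUnion_openConnVia_box x y).symm
  set p' := p / (p + q * (1 - p)) with hp'
  -- (1) the two sides converge as `m → ∞`
  have hA : Antitone fun m => {ω : BondConfig (Site d) | s(x, y) ∈ ω} ∩ H ∩ (f ⁻¹' Km m)ᶜ :=
    fun m m' hmm' => Set.inter_subset_inter_right _
      (Set.compl_subset_compl.2 (Set.preimage_mono (hmono hmm')))
  have hB : Antitone fun m => H ∩ (f ⁻¹' Km m)ᶜ :=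
    fun m m' hmm' => Set.inter_subset_inter_right _
      (Set.compl_subset_compl.2 (Set.preimage_mono (hmono hmm')))
  have h1 := tendsto_measureReal_iInter_of_antitone P hA
    fun m => ((measurableSet_mem _).inter hHm).inter ((hKmm m).preimage hfm).compl
  have h2 := (tendsto_measureReal_iInter_of_antitone P hB
    fun m => hHm.inter ((hKmm m).preimage hfm).compl).const_mul p'
  rw [← Set.inter_iInter, ← Set.compl_iUnion, ← Set.preimage_iUnion, hunion] at h1 h2
  -- (2) the deviation tends to `0`
  have hdev : Tendsto (fun m => P.real ({ω : BondConfig (Site d) | s(x, y) ∈ ω} ∩ H ∩ (f ⁻¹' Km m)ᶜ) -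
      p' * P.real (H ∩ (f ⁻¹' Km m)ᶜ)) atTop (𝓝 0) := by
    have hup : Tendsto (fun m : ℕ => (p - p') * P.real
        (f ⁻¹' {ω | ∃ c ∈ box d (m + 1), c ∉ box d m ∧
            ω ∈ openConnVia (withinGraph ⊤ (↑(box d (m + 1)) : Set (Site d))) x c} ∩
          f ⁻¹' {ω | ∃ c ∈ box d (m + 1), c ∉ box d m ∧
            ω ∈ openConnVia (withinGraph ⊤ (↑(box d (m + 1)) : Set (Site d))) y c} ∩
          (f ⁻¹' Km m)ᶜ)) atTop (𝓝 0) := by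
      rcases eq_or_lt_of_le hp.2 with hp1 | hp1
      · have h0 : p - p' = 0 := by rw [hp', hp1]; norm_num
        simp only [h0, zero_mul]
        exact tendsto_const_nhds
      · rw [← mul_zero (p - p')]
        exact (hP.tendsto_real_exit_inter_not_openConnVia ⟨hp.1, hp1⟩ hq huniq x y).const_mul _
    refine tendsto_of_tendsto_of_tendsto_of_le_of_le' tendsto_const_nhds hup ?_ ?_
    · filter_upwards [eventually_ge_atTop m₀] with m hm
      exact (hP.real_edgeOpen_inter_sub_mul_mem_Icc hp hq hxy (hx m hm) (hy m hm) hH heT).1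
    · filter_upwards [eventually_ge_atTop m₀] with m hm
      exact (hP.real_edgeOpen_inter_sub_mul_mem_Icc hp hq hxy (hx m hm) (hy m hm) hH heT).2
  -- (3) conclude
  have := tendsto_nhds_unique (h1.sub h2) hdev
  linarith

/-- **Grimmett's (4.38), second case, hypothesis-free**: for EVERY box limit `P` (`0 ≤ p ≤ 1`, `q ≥ 1`,
either boundary condition), every lattice edge `e = ⟨x,y⟩` and every `H` determined by finitely many
pairs other than `e`, `P({e open} ∩ H ∖ K_e) = p/(p + q(1-p)) · P(H ∖ K_e)` — the a.s. uniqueness of the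
infinite cluster being the cell's Burton–Keane theorem `IsBoxLimit.ae_numInfiniteClusters_le_one'`.
[cite: Grimmett2006, Thm. (4.34)(b) with Prop. (4.37) eq. (4.38) and Thm. (4.33)(c)] -/
theorem IsBoxLimit.real_edgeOpen_inter_not_offEdgeConn_eq_mul (hP : IsBoxLimit d b p q P)
    (hp : p ∈ Set.Icc (0 : ℝ) 1) (hq : 1 ≤ q) {x y : Site d} (hxy : (zdGraph d).Adj x y)
    {H : Set (BondConfig (Site d))} {T : Finset (Sym2 (Site d))} (hH : DeterminedBy H ↑T)
    (heT : s(x, y) ∉ T) :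
    P.real ({ω | s(x, y) ∈ ω} ∩ H ∩ ((fun η => η \ {s(x, y)}) ⁻¹' openConn x y)ᶜ) =
      p / (p + q * (1 - p)) * P.real (H ∩ ((fun η => η \ {s(x, y)}) ⁻¹' openConn x y)ᶜ) :=
  hP.real_edgeOpen_inter_not_offEdgeConn_eq_mul_of_ae hp hq (hP.ae_numInfiniteClusters_le_one' hp hq)
    hxy hH heT

/-! ### (4.38) assembled: the one-edge DLR equation -/

/-- **The one-edge DLR equation** (Grimmett 2006, Def. (4.29) eq. (4.30) for `Λ = {e}`, i.e. Prop. (4.37)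
eq. (4.38); Thm. (4.34)(b) `φ^b_{p,q} ∈ R_{p,q}`), HYPOTHESIS-FREE: for every box limit `P` (`0 ≤ p ≤ 1`,
`q ≥ 1`, either boundary condition), every lattice edge `e = ⟨x,y⟩` and every `H` determined by finitely
many pairs other than `e`,
`P({e open} ∩ H) = p · P(H ∩ K_e) + p/(p + q(1-p)) · P(H ∖ K_e)`:
the conditional probability that `e` is open given the other edges is `φ^ω_{e,p,q}(e open)`.
[cite: Grimmett2006, Def. (4.29)–(4.30), Thm. (4.34)(b), Prop. (4.37) eq. (4.38)] -/
theorem IsBoxLimit.real_edgeOpen_inter_eq (hP : IsBoxLimit d b p q P)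
    (hp : p ∈ Set.Icc (0 : ℝ) 1) (hq : 1 ≤ q) {x y : Site d} (hxy : (zdGraph d).Adj x y) {H : Set (BondConfig (Site d))}
    {T : Finset (Sym2 (Site d))} (hH : DeterminedBy H ↑T) (heT : s(x, y) ∉ T) :
    P.real ({ω | s(x, y) ∈ ω} ∩ H) =
      p * P.real (H ∩ (fun η => η \ {s(x, y)}) ⁻¹' openConn x y) +
        p / (p + q * (1 - p)) * P.real (H ∩ ((fun η => η \ {s(x, y)}) ⁻¹' openConn x y)ᶜ) := by
  haveI := hP.isProbabilityMeasure
  have hKm : MeasurableSet ((fun η : BondConfig (Site d) => η \ {s(x, y)}) ⁻¹' openConn x y) :=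
    (measurableSet_openConn_holds x y).preimage (measurable_closeEdges _)
  rw [← hP.real_edgeOpen_inter_offEdgeConn_eq_mul hp (one_pos.trans_le hq) hxy hH heT,
    ← hP.real_edgeOpen_inter_not_offEdgeConn_eq_mul hp hq hxy hH heT,
    ← measureReal_inter_add_sdiff₀ (s := {ω : BondConfig (Site d) | s(x, y) ∈ ω} ∩ H) hKm.nullMeasurableSet,
    Set.sdiff_eq]

/-- **The one-edge DLR equation for THE limits `φ^b_{p,q} = rcLimit d b p q`** (`0 ≤ p ≤ 1`, `q ≥ 1`,
`b` free or wired): Grimmett 2006, Thm. (4.34)(b) in the one-edge form (4.38), unconditional.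
[cite: Grimmett2006, Thm. (4.34)(b) with Prop. (4.37) eq. (4.38)] -/
theorem rcLimit_real_edgeOpen_inter_eq (b : Bool) (hp : p ∈ Set.Icc (0 : ℝ) 1) (hq : 1 ≤ q)
    {x y : Site d} (hxy : (zdGraph d).Adj x y) {H : Set (BondConfig (Site d))}
    {T : Finset (Sym2 (Site d))} (hH : DeterminedBy H ↑T) (heT : s(x, y) ∉ T) :
    (rcLimit d b p q).real ({ω | s(x, y) ∈ ω} ∩ H) =
      p * (rcLimit d b p q).real (H ∩ (fun η => η \ {s(x, y)}) ⁻¹' openConn x y) +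
        p / (p + q * (1 - p)) *
          (rcLimit d b p q).real (H ∩ ((fun η => η \ {s(x, y)}) ⁻¹' openConn x y)ᶜ) :=
  (isBoxLimit_rcLimit b hp hq).real_edgeOpen_inter_eq hp hq hxy hH heT

end Limit

end Summit.CriticalPhenomena.PercolationContinuityZ3.Theorems.FK

end
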